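import Literature.MathematicalPhysics.QuantumFieldTheory.Balaban1983to89.B6MajorantTransferSteps
import Literature.MathematicalPhysics.QuantumFieldTheory.Balaban1983to89.B6Prop26Gluing

/-!
# `Balaban1983to89.B6CommutatorZoneKernels` — T. Bałaban, *Propagators and renormalization transformations for lattice gauge theories. II*,
# Commun. Math. Phys. **96** (1984) 223–250 [Balaban1984PropagatorsII], (2.39) p. 229 / (2.92) p. 239 (the commutator of a smooth cut-off with a
# lattice operator is FIRST ORDER with coefficients of size `M⁻¹`) × (2.51)–(2.55) p. 232 (block majorants compose): THE ZONE KERNELS OF A COMMUTATOR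
# `[χ, Δ′]G′` FROM A FIRST-ORDER DECOMPOSITION — the displayed hypotheses `mKG`/`mKGw`/`mKGE`/`mKGwE` of `…B6DomainChangeP2134Sizes.line3P_hasMajorant`
# DERIVED from `[χ, Δ′] = Σ_e c_e·E_e + V` with zone-supported coefficients `|c_e| ≤ s₁/(M·w)`, a block-diagonal `V` of size `s₂/(M·w²)`, and the
# leg majorants of `E_eG′`, `G′`, `E_eG′∂*`, `G′∂*`

statement-level skeleton of published theorems with citation tags; proofs where landed; nothing here is a claim about the Yang–Mills mass gap

PDF held: `paper:balaban1984-cmp96-propagators-rt-ii` (journal page = PDF page + 222): p. 229 [PDF 7] ((2.39): *"the operator … is a first order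
operator with coefficients bounded by O(M⁻¹)"*-type display for `h(−Δ) − (−Δ)h`), p. 232 [PDF 10] ((2.51)–(2.55): *"this property is preserved under
the composition of operators possessing it … A summation preserves it also"*), p. 239 [PDF 17] ((2.92) line 1: *"Σ_{b∈st(x)}(∂h_□)(b)(∂A_μ)(b) −
(Δh_□)(x)A_μ(x)"*), p. 247 [PDF 25] ((2.134)–(2.135): the factor `O(M⁻¹)`).

CITATION HEADER (lean-in-tree rule) — WHAT IS REPRODUCED.  Phase-2 file of the `lit-balaban` typed skeleton (HOME `run/shared/lean/pub/lit-balaban/`),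
seat **p38 gen 27** (free-target protocol G.5-34(d); B6 fold owner r03 gen 20, p22 gen 20's request of 2026-08-23T04:33Z *«are the zone kernels
[χ,Δ′_a]G′ displayed or derived inside (C)?»* — answered: displayed in (C) = `…B6DomainChangeP2134Sizes`, DERIVED HERE); SKELETON rows **B6.Eq2.92** ×
**B6.Eq2.51** × **B6.Eq2.134** (cells only; decls of record untouched).  THIS FILE = the bookkeeping step *«a first-order operator with zone-supported
coefficients of size M⁻¹, composed with a propagator of the (2.67)-type, has a zone kernel of size M⁻¹»*, in the block-majorant calculus of
`…B6RandomWalk`/`…B6RandomWalkHom` (pv08/p06), for the letters of `…B6DomainChangeP2134Sizes.line3P_hasMajorant` (p38 gen 27):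
* §1 tools: `hom_mulOp_coeff` / `hasMajorant_mulOp_coeff` (a multiplier with the block-dependent bound `|f| ≤ σ(y(·))`, vanishing off the zone `N`,
  in front of an operator with majorant `K` gives `1_N(y)σ(y)K(y,y′)`), `hom_finset_sum` / `hasMajorant_finset_sum` (majorants of finite sums),
  `hasMajorant_mulOp_diag` (a multiplier is block-diagonal), `hom_diag_comp` / `hasMajorant_diag_mul` (a block-diagonal left factor multiplies the
  majorant pointwise — no convolution, no loss of rate), `mulOp_eq_gluing` (the two `mulOp`s of the tree agree, `rfl`);
* §2 **`commZone_mul`**: `[χ, D] = Σ_{e∈DE} c_e·E_e + V`, `|c_e(x)| ≤ s₁/(M·w(y(x)))` and `c_e = 0` off the zone `N`, `V` block-diagonal of size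
  `1_N·s₂/(M·w²)`, `E_eG` with majorant `C₁′·w·e^{−δd}`, `G` with `B₁·w²·e^{−δd}` ⟹ `[χ, D]G` has the majorant `1_N(y)·θ·e^{−δd}`,
  **`θ = (|DE|·s₁C₁′ + s₂B₁)/M`** — the shape `mKG`/`mKGw`; **`commZone_leg`**: the same against the right leg `G∂*` (`E_eG∂*` with `C₂·e^{−δd}`, `G∂*`
  with `C₁·w·e^{−δd}`, two lattices) ⟹ `1_N(y)·θ₁·w(y)⁻¹·e^{−δd}`, **`θ₁ = (|DE|·s₁C₂ + s₂C₁)/M`** — the shape `mKGE`/`mKGwE`.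
THEOREMS ONLY (no `def`, no `def … : Prop`, no new hypothesis); standard axioms.

HONEST SCOPE / DIVERGENCES. (1) Bookkeeping in OUR block-majorant vocabulary; print performs this step inside the proof of (2.134) without display.
(2) The decomposition `[χ, D] = Σ c_eE_e + V` and the sizes `s₁`, `s₂` are the CONSUMER's (for the V1 site operator `Δ′` of (2.17): `E_e` = the
shifted differences read on sites, `c_e = ±c′²(∂χ)(· ± e_μ)`, `V` = `c′²(Δχ)` plus the averaging commutator `[χ, a(Lʲη)⁻²Q′*Q′]`, block-diagonal when
the averaging blocks refine the blocks of `y(·)`); the smooth `χ` with `|∂χ| ≤ s₁/(M·Lʲη)` on the zone is the consumer's choice (p38 gen 25/27 design,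
`…B6DomainChangeP2134` header). (3) Weights `w > 0` and `M > 0` arbitrary reals; constants ours.  NOT summit progress.  Unit `lit-balaban-p38` (gen 27),
2026-08-23.

v1.1 (p38 gen 27; p22 gen 20's flag 2026-08-23T06:49Z/07:00Z and r03 gen 21 07:05Z): the all-pairs input `mEGE` (`E_e∘G′∂* ~ C₂e^{−δd}`) of `commZone_leg`
is NOT level-uniform (its diagonal blocks carry the Calderón–Zygmund logarithm of `∇G′∇*`; print's (2.67)/(2.138) never list a sup-norm mixed entry), so
`commZone_leg` is kept but superseded for term 6 of line 3 by §3 **`commZone_right`**: the commutator to the RIGHT of the resolvent, `G′·[χ,Δ′]`, after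
SUMMATION BY PARTS (`c_e·∇_e = ∇_e·c_e(·−e) + (c_e(·−e) − c_e)`, displayed as `hbp`) is `Σ_e (G′∇_e)·c_e(·−e) + G′·(c_e(·−e) − c_e) + G′·V` — the
difference lands on the COLUMN variable of `G′` ((2.67)₃, one derivative) and the coefficients become column multipliers over the zone: the COLUMN-zone
kernel `1_N(y′)·θ₂·e^{−(δ−2κ)d}`, `θ₂ = (#DE·(Λs₁C₁′ + Λ²s₂B₁) + Λ²s₂B₁)/M` (two transfers (2.60)), the input `mGK` of `…Sizes.line3P_hasMajorant_gk`.
-/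

namespace Literature.MathematicalPhysics.QuantumFieldTheory.Balaban1983to89.B6CommutatorZoneKernels

open B6RandomWalk (HasMajorant BlockSupp hasMajorant_mono hasMajorant_add hasMajorant_mul hasMajorant_zero)
open B6RandomWalkHom (HasMajorantHom hasMajorantHom_iff hasMajorantHom_mono hasMajorantHom_add hasMajorantHom_comp hasMajorantHom_zero)
open B9Thm37Sum (mulOp mulOp_apply)
open B4Sect5Torus (IsPseudoDist)

variable {g : B6.Geometry}

/-! ## §1  Tools: coefficient cuts, finite sums, block-diagonal factors -/

section Tools

variable {X Y : Type}

/-- the `mulOp` of `…B9Thm37Sum` (used by `…B6DomainMajorant`, `…B6DomainChangeP2134Sizes`) IS the `mulOp` of `…B6Prop26Gluing` (used by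
`…B6Ineq2134KFamKLevelTorus.h2134_kFam_torus`, `…B6CubeWindowV1`), by `rfl` — one multiplication operator `h_□·` of (2.91).
[cite: Balaban1984PropagatorsII, (2.91) p.239 («G₀ = Σ_□ h_□G_□h_□», multiplication by h_□), dictionary] -/
theorem mulOp_eq_gluing (f : X → ℝ) : (mulOp f : Module.End ℝ (X → ℝ)) = B6Prop26Gluing.mulOp f := rfl

variable [DecidableEq g.Site]

/-- **coefficient cut (two lattices)**: a multiplier `f` with the block-dependent bound `|f(v)| ≤ σ(y(v))`, vanishing off the blocks of the zone `N`,
in front of `T` (majorant `K ≥ 0`) gives the majorant `1_N(y)·σ(y)·K(y,y′)` — the coefficient `(∂h_□)(b)` of (2.92) line 1 in front of `∂G`.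
[cite: Balaban1984PropagatorsII, (2.92) p.239 (line 1), (2.51) p.232] -/
theorem hom_mulOp_coeff (blkX : X → g.Site) (blkY : Y → g.Site) {T : (X → ℝ) →ₗ[ℝ] (Y → ℝ)} {K : g.Site → g.Site → ℝ}
    (hT : HasMajorantHom blkX blkY T K) {f : Y → ℝ} {σ : g.Site → ℝ} (hf : ∀ v, |f v| ≤ σ (blkY v))
    (N : Finset g.Site) (hf0 : ∀ v, f v ≠ 0 → blkY v ∈ N) :
    HasMajorantHom blkX blkY (mulOp f ∘ₗ T) (fun a b => (if a ∈ N then σ a else 0) * K a b) := by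
  intro y' μ B hμ v
  dsimp only
  rw [LinearMap.comp_apply, mulOp_apply, abs_mul]
  by_cases hv : blkY v ∈ N
  · rw [if_pos hv]
    calc |f v| * |T μ v| ≤ σ (blkY v) * (K (blkY v) y' * B) :=
          mul_le_mul (hf v) (hT y' μ B hμ v) (abs_nonneg _) ((abs_nonneg _).trans (hf v))
      _ = σ (blkY v) * K (blkY v) y' * B := by ring
  · have h0 : f v = 0 := by
      by_contra hne
      exact hv (hf0 v hne)
    rw [h0, abs_zero, zero_mul, if_neg hv, zero_mul, zero_mul]

/-- **coefficient cut (one lattice)**: `|f| ≤ σ(y(·))`, `f = 0` off the zone `N` ⟹ `f·T` has the majorant `1_N(y)σ(y)K(y,y′)`.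
[cite: Balaban1984PropagatorsII, (2.92) p.239 (line 1), (2.51) p.232] -/
theorem hasMajorant_mulOp_coeff (blk : X → g.Site) {T : Module.End ℝ (X → ℝ)} {K : g.Site → g.Site → ℝ}
    (hT : HasMajorant blk T K) {f : X → ℝ} {σ : g.Site → ℝ} (hf : ∀ x, |f x| ≤ σ (blk x))
    (N : Finset g.Site) (hf0 : ∀ x, f x ≠ 0 → blk x ∈ N) :
    HasMajorant blk (mulOp f * T) (fun a b => (if a ∈ N then σ a else 0) * K a b) :=
  (hasMajorantHom_iff blk _ _).1 (hom_mulOp_coeff blk blk ((hasMajorantHom_iff blk T K).2 hT) hf N hf0)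

omit [DecidableEq g.Site] in
/-- **finite sums (two lattices)**: *"A summation preserves it also"* — over any finite index set. [cite: Balaban1984PropagatorsII, p.232] -/
theorem hom_finset_sum (blkX : X → g.Site) (blkY : Y → g.Site) {ι : Type} (s : Finset ι) {T : ι → (X → ℝ) →ₗ[ℝ] (Y → ℝ)}
    {K : ι → g.Site → g.Site → ℝ} (h : ∀ i ∈ s, HasMajorantHom blkX blkY (T i) (K i)) :
    HasMajorantHom blkX blkY (∑ i ∈ s, T i) (fun a b => ∑ i ∈ s, K i a b) := by
  classical
  induction s using Finset.induction_on with
  | empty => simpa using hasMajorantHom_zero blkX blkY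
  | @insert i s hi ih =>
      have h1 := h i (Finset.mem_insert_self i s)
      have h2 := ih (fun j hj => h j (Finset.mem_insert_of_mem hj))
      have h12 := hasMajorantHom_add blkX blkY h1 h2
      rw [Finset.sum_insert hi]
      refine hasMajorantHom_mono blkX blkY h12 (fun a b => le_of_eq ?_)
      rw [Finset.sum_insert hi]

omit [DecidableEq g.Site] in
/-- **finite sums (one lattice)**. [cite: Balaban1984PropagatorsII, p.232] -/
theorem hasMajorant_finset_sum (blk : X → g.Site) {ι : Type} (s : Finset ι) {T : ι → Module.End ℝ (X → ℝ)}
    {K : ι → g.Site → g.Site → ℝ} (h : ∀ i ∈ s, HasMajorant blk (T i) (K i)) :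
    HasMajorant blk (∑ i ∈ s, T i) (fun a b => ∑ i ∈ s, K i a b) :=
  (hasMajorantHom_iff blk _ _).1 (hom_finset_sum blk blk s (fun i hi => (hasMajorantHom_iff blk (T i) (K i)).2 (h i hi)))

/-- **a multiplier is block-diagonal**: `|c(x)| ≤ v(y(x))` ⟹ `c·` has the majorant `1_{y = y′}·v(y)` (the `(Δh_□)(x)A_μ(x)` term of (2.92) line 1).
[cite: Balaban1984PropagatorsII, (2.92) p.239 (line 1), (2.51) p.232] -/
theorem hasMajorant_mulOp_diag (blk : X → g.Site) {c : X → ℝ} {v : g.Site → ℝ} (hc : ∀ x, |c x| ≤ v (blk x)) :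
    HasMajorant blk (mulOp c) (fun a b => if a = b then v a else 0) := by
  intro y' μ B hμ x
  dsimp only
  rw [mulOp_apply, abs_mul]
  by_cases hx : blk x = y'
  · rw [if_pos hx]
    exact mul_le_mul (hc x) (hμ.bound x hx) (abs_nonneg _) ((abs_nonneg _).trans (hc x))
  · rw [hμ.off x hx, abs_zero, mul_zero, if_neg hx, zero_mul]

/-- **a block-diagonal left factor multiplies the majorant pointwise** (two lattices): `V` with majorant `1_{y=y′}v(y)` composed with `T`
(majorant `K ≥ 0`) has the majorant `v(y)K(y,y′)` — (2.52)–(2.55) with the 𝔅-sum collapsing to the diagonal.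
[cite: Balaban1984PropagatorsII, (2.52)–(2.55) p.232] -/
theorem hom_diag_comp (blkX : X → g.Site) (blkY : Y → g.Site) {V : Module.End ℝ (Y → ℝ)} {v : g.Site → ℝ}
    {T : (X → ℝ) →ₗ[ℝ] (Y → ℝ)} {K : g.Site → g.Site → ℝ}
    (hV : HasMajorant blkY V (fun a b => if a = b then v a else 0)) (hT : HasMajorantHom blkX blkY T K) (hK : ∀ a b, 0 ≤ K a b) :
    HasMajorantHom blkX blkY (V ∘ₗ T) (fun a b => v a * K a b) := by
  have h := hasMajorantHom_comp blkX blkY blkY ((hasMajorantHom_iff blkY V _).2 hV) hT hK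
  refine hasMajorantHom_mono blkX blkY h (fun a b => le_of_eq ?_)
  simp only [ite_mul, zero_mul, Finset.sum_ite_eq, Finset.mem_univ, if_true]

/-- **a block-diagonal left factor multiplies the majorant pointwise** (one lattice). [cite: Balaban1984PropagatorsII, (2.52)–(2.55) p.232] -/
theorem hasMajorant_diag_mul (blk : X → g.Site) {V T : Module.End ℝ (X → ℝ)} {v : g.Site → ℝ} {K : g.Site → g.Site → ℝ}
    (hV : HasMajorant blk V (fun a b => if a = b then v a else 0)) (hT : HasMajorant blk T K) (hK : ∀ a b, 0 ≤ K a b) :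
    HasMajorant blk (V * T) (fun a b => v a * K a b) :=
  (hasMajorantHom_iff blk _ _).1 (hom_diag_comp blk blk hV ((hasMajorantHom_iff blk T K).2 hT) hK)

end Tools

/-! ## §2  The zone kernels of `[χ, D]G` and `[χ, D]G∂*` from a first-order decomposition -/

section Main

variable [DecidableEq g.Site] {Xs Y : Type}

omit [DecidableEq g.Site] in
/-- `(Σ_i T_i) ∘ S = Σ_i (T_i ∘ S)` for linear maps. [folklore] -/
private theorem sum_comp {ι : Type} (s : Finset ι) (T : ι → Module.End ℝ (Xs → ℝ)) (S : (Y → ℝ) →ₗ[ℝ] (Xs → ℝ)) :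
    (∑ i ∈ s, T i) ∘ₗ S = ∑ i ∈ s, (T i ∘ₗ S) := by
  refine LinearMap.ext fun f => ?_
  rw [LinearMap.comp_apply, LinearMap.sum_apply, LinearMap.sum_apply]
  rfl

/-- **THE ZONE KERNEL OF `[χ, D]·G`** (the shape `mKG`/`mKGw` of `…B6DomainChangeP2134Sizes.line3P_hasMajorant`): if
`χD − Dχ = Σ_{e∈DE} c_e·E_e + V` with `|c_e(x)| ≤ s₁/(M·w(y(x)))`, `c_e = 0` off the zone `N`, `V` block-diagonal of size `1_N(y)·s₂/(M·w(y)²)`,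
and `E_eG`, `G` have the majorants `C₁′w(y)e^{−δd}`, `B₁w(y)²e^{−δd}`, then `(χD − Dχ)G` has the majorant `1_N(y)·((|DE|s₁C₁′ + s₂B₁)/M)·e^{−δd(y,y′)}`
— a zone kernel of size `M⁻¹` (the mechanism of the factor `O(M⁻¹)` in (2.134)). [cite: Balaban1984PropagatorsII, (2.92) p.239 (line 1), (2.134) p.247, (2.51)–(2.55) p.232] -/
theorem commZone_mul (blkS : Xs → g.Site) {D G V : Module.End ℝ (Xs → ℝ)} {χ : Xs → ℝ}
    {ι : Type} {DE : Finset ι} {E : ι → Module.End ℝ (Xs → ℝ)} {cf : ι → Xs → ℝ}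
    (N : Finset g.Site) {w : g.Site → ℝ} (hw : ∀ a, 0 < w a) {M s₁ s₂ C₁' B₁ δ : ℝ} (hM : 0 < M) (hB₁ : 0 ≤ B₁)
    (hdec : mulOp χ * D - D * mulOp χ = (∑ e ∈ DE, mulOp (cf e) * E e) + V)
    (hcf : ∀ e ∈ DE, ∀ x, |cf e x| ≤ s₁ / (M * w (blkS x))) (hcfN : ∀ e ∈ DE, ∀ x, cf e x ≠ 0 → blkS x ∈ N)
    (hV : HasMajorant blkS V (fun a b => if a = b then (if a ∈ N then s₂ / (M * w a ^ 2) else 0) else 0))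
    (mEG : ∀ e ∈ DE, HasMajorant blkS (E e * G) (fun a b => C₁' * w a * Real.exp (-(δ * g.dist a b))))
    (mG : HasMajorant blkS G (fun a b => B₁ * w a ^ 2 * Real.exp (-(δ * g.dist a b)))) :
    HasMajorant blkS ((mulOp χ * D - D * mulOp χ) * G)
      (fun a b => (if a ∈ N then (DE.card * (s₁ * C₁') + s₂ * B₁) / M else 0) * Real.exp (-(δ * g.dist a b))) := by
  classical
  rw [hdec, add_mul, Finset.sum_mul]
  -- the first-order terms `c_e·E_e·G`
  have h1 : ∀ e ∈ DE, HasMajorant blkS (mulOp (cf e) * E e * G)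
      (fun a b => (if a ∈ N then s₁ * C₁' / M else 0) * Real.exp (-(δ * g.dist a b))) := by
    intro e he
    rw [mul_assoc]
    have h := hasMajorant_mulOp_coeff blkS (mEG e he) (σ := fun a => s₁ / (M * w a)) (hcf e he) N (hcfN e he)
    refine hasMajorant_mono blkS h (fun a b => le_of_eq ?_)
    by_cases ha : a ∈ N
    · rw [if_pos ha, if_pos ha]
      have hwa := hw a
      field_simp
    · rw [if_neg ha, if_neg ha, zero_mul, zero_mul]
  have hsum := hasMajorant_finset_sum blkS DE h1
  -- the block-diagonal term `V·G`
  have h0 : HasMajorant blkS (V * G) (fun a b => (if a ∈ N then s₂ * B₁ / M else 0) * Real.exp (-(δ * g.dist a b))) := by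
    have h := hasMajorant_diag_mul blkS hV mG (fun a b => by positivity)
    refine hasMajorant_mono blkS h (fun a b => le_of_eq ?_)
    by_cases ha : a ∈ N
    · rw [if_pos ha, if_pos ha]
      have hwa := hw a
      field_simp
    · rw [if_neg ha, if_neg ha, zero_mul, zero_mul]
  refine hasMajorant_mono blkS (hasMajorant_add blkS hsum h0) (fun a b => le_of_eq ?_)
  rw [Finset.sum_const, nsmul_eq_mul]
  by_cases ha : a ∈ N
  · rw [if_pos ha, if_pos ha, if_pos ha]
    field_simp
  · rw [if_neg ha, if_neg ha, if_neg ha]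
    ring

/-- **THE ZONE KERNEL OF `[χ, D]·G∂*`** (the right leg; the shape `mKGE`/`mKGwE` of `…line3P_hasMajorant`): with the same decomposition and
coefficient sizes, `E_e(G∂*)` with the majorant `C₂e^{−δd}` (weight `w⁰`, two lattices `Y → X`) and `G∂*` with `C₁w(y)e^{−δd}`,
`(χD − Dχ)(G∂*)` has the majorant `1_N(y)·((|DE|s₁C₂ + s₂C₁)/M)·w(y)⁻¹·e^{−δd(y,y′)}`.
[cite: Balaban1984PropagatorsII, (2.92) p.239 (line 1), (2.134) p.247, (2.51)–(2.55) p.232, (2.67) p.234] -/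
theorem commZone_leg (blkS : Xs → g.Site) (blkY : Y → g.Site) {D V : Module.End ℝ (Xs → ℝ)} {GE : (Y → ℝ) →ₗ[ℝ] (Xs → ℝ)} {χ : Xs → ℝ}
    {ι : Type} {DE : Finset ι} {E : ι → Module.End ℝ (Xs → ℝ)} {cf : ι → Xs → ℝ}
    (N : Finset g.Site) {w : g.Site → ℝ} (hw : ∀ a, 0 < w a) {M s₁ s₂ C₂ C₁ δ : ℝ} (hM : 0 < M) (hC₁ : 0 ≤ C₁)
    (hdec : mulOp χ * D - D * mulOp χ = (∑ e ∈ DE, mulOp (cf e) * E e) + V)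
    (hcf : ∀ e ∈ DE, ∀ x, |cf e x| ≤ s₁ / (M * w (blkS x))) (hcfN : ∀ e ∈ DE, ∀ x, cf e x ≠ 0 → blkS x ∈ N)
    (hV : HasMajorant blkS V (fun a b => if a = b then (if a ∈ N then s₂ / (M * w a ^ 2) else 0) else 0))
    (mEGE : ∀ e ∈ DE, HasMajorantHom blkY blkS (E e ∘ₗ GE) (fun a b => C₂ * Real.exp (-(δ * g.dist a b))))
    (mGE : HasMajorantHom blkY blkS GE (fun a b => C₁ * w a * Real.exp (-(δ * g.dist a b)))) :
    HasMajorantHom blkY blkS ((mulOp χ * D - D * mulOp χ) ∘ₗ GE)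
      (fun a b => (if a ∈ N then (DE.card * (s₁ * C₂) + s₂ * C₁) / M else 0) * (w a)⁻¹ * Real.exp (-(δ * g.dist a b))) := by
  classical
  rw [hdec, LinearMap.add_comp, sum_comp]
  -- the first-order terms `c_e·E_e·(G∂*)`
  have h1 : ∀ e ∈ DE, HasMajorantHom blkY blkS ((mulOp (cf e) * E e) ∘ₗ GE)
      (fun a b => (if a ∈ N then s₁ * C₂ / M else 0) * (w a)⁻¹ * Real.exp (-(δ * g.dist a b))) := by
    intro e he
    rw [Module.End.mul_eq_comp, LinearMap.comp_assoc]
    have h := hom_mulOp_coeff blkY blkS (mEGE e he) (σ := fun a => s₁ / (M * w a)) (hcf e he) N (hcfN e he)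
    refine hasMajorantHom_mono blkY blkS h (fun a b => le_of_eq ?_)
    by_cases ha : a ∈ N
    · rw [if_pos ha, if_pos ha]
      have hwa := hw a
      field_simp
    · rw [if_neg ha, if_neg ha, zero_mul, zero_mul, zero_mul]
  have hsum := hom_finset_sum blkY blkS DE h1
  -- the block-diagonal term `V·(G∂*)`
  have h0 : HasMajorantHom blkY blkS (V ∘ₗ GE)
      (fun a b => (if a ∈ N then s₂ * C₁ / M else 0) * (w a)⁻¹ * Real.exp (-(δ * g.dist a b))) := by
    have h := hom_diag_comp blkY blkS hV mGE (fun a b => mul_nonneg (mul_nonneg hC₁ (hw a).le) (Real.exp_pos _).le)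
    refine hasMajorantHom_mono blkY blkS h (fun a b => le_of_eq ?_)
    by_cases ha : a ∈ N
    · rw [if_pos ha, if_pos ha]
      have hwa := hw a
      field_simp
    · rw [if_neg ha, if_neg ha, zero_mul, zero_mul, zero_mul]
  refine hasMajorantHom_mono blkY blkS (hasMajorantHom_add blkY blkS hsum h0) (fun a b => le_of_eq ?_)
  rw [Finset.sum_const, nsmul_eq_mul]
  by_cases ha : a ∈ N
  · rw [if_pos ha, if_pos ha, if_pos ha]
    field_simp
  · rw [if_neg ha, if_neg ha, if_neg ha]
    ring

end Main

/-! ## §3  v1.1: the commutator to the RIGHT of the resolvent — `G′[χ,Δ′]` by summation by parts (column-zone kernel; input `mGK` of line 3 v1.2) -/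

section Right

variable [DecidableEq g.Site] {Xs : Type}

/-- **column coefficient cut**: `T·(f·)` with `|f(x)| ≤ σ(y(x))`, `σ ≥ 0`, `f` vanishing off the blocks of `N`, behind `T` (majorant `K ≥ 0`) has the majorant
`K(y,y′)·1_N(y′)·σ(y′)` — a coefficient read at the INPUT block. [cite: Balaban1984PropagatorsII, (2.92) p.239 (line 1), (2.51) p.232] -/
theorem hasMajorant_mul_mulOp_coeff (blk : Xs → g.Site) {T : Module.End ℝ (Xs → ℝ)} {K : g.Site → g.Site → ℝ}
    (hT : HasMajorant blk T K) {f : Xs → ℝ} {σ : g.Site → ℝ} (hσ : ∀ b, 0 ≤ σ b) (hf : ∀ x, |f x| ≤ σ (blk x))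
    (N : Finset g.Site) (hf0 : ∀ x, f x ≠ 0 → blk x ∈ N) :
    HasMajorant blk (T * mulOp f) (fun a b => K a b * (if b ∈ N then σ b else 0)) := by
  intro y' μ B hμ x
  dsimp only
  rw [Module.End.mul_apply]
  by_cases hy : y' ∈ N
  · rw [if_pos hy]
    have hν : BlockSupp blk (mulOp f μ) y' (σ y' * B) := by
      refine ⟨mul_nonneg (hσ _) hμ.nonneg, fun x' hx' => ?_, fun x' hx' => ?_⟩
      · rw [mulOp_apply, abs_mul]
        exact mul_le_mul (hx' ▸ hf x') (hμ.bound x' hx') (abs_nonneg _) (hσ _)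
      · rw [mulOp_apply, hμ.off x' hx', mul_zero]
    calc |T (mulOp f μ) x| ≤ K (blk x) y' * (σ y' * B) := hT y' _ _ hν x
      _ = K (blk x) y' * σ y' * B := by ring
  · rw [if_neg hy, mul_zero, zero_mul]
    have h0 : mulOp f μ = 0 := by
      funext x'
      rw [mulOp_apply, Pi.zero_apply]
      by_cases hx' : blk x' = y'
      · have hz : f x' = 0 := by
          by_contra hne
          exact hy (hx' ▸ hf0 x' hne)
        rw [hz, zero_mul]
      · rw [hμ.off x' hx', mul_zero]
    rw [h0, map_zero, Pi.zero_apply, abs_zero]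

/-- **THE COMMUTATOR TO THE RIGHT OF THE RESOLVENT, `G′·[χ,Δ′]`, HAS THE COLUMN-ZONE KERNEL `1_N(y′)·θ₂·e^{−(δ−2κ)d}`, `θ₂ = O(M⁻¹)`** (term 6 of (2.92)
line 3 in `…B6DomainChangeP2134Sizes.line3P_hasMajorant_gk`: input `mGK`).  DISPLAYED: the by-parts decomposition
`[χ,Δ′] = Σ_{e∈DE} (F_e·c^s_e + d_e·) + v·` (`F_e` = the forward difference, `c^s_e = c_e(·−e)`, `d_e = c_e(·−e) − c_e`: the product rule
`c_e·∇_e = ∇_e·c_e(·−e) + (c_e(·−e) − c_e)·`), column bounds `|c^s_e| ≤ s₁/(Mw)`, `|d_e|, |v| ≤ s₂/(Mw²)` supported over the zone `N`, the right-difference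
legs `G′F_e ~ C₁′w(y)e^{−δd}` ((2.67)₃: one COLUMN difference of `G′`), `G′ ~ B₁w²e^{−δd}` ((2.67)₁), the transfer `e^{−κd}w(y″) ≤ Λw(y)` ((2.60), `κ ≥ 0`).
No second difference of `G′` occurs. [cite: Balaban1984PropagatorsII, (2.92) p.239 (line 3), p.238 («[χ,Δ′] gives O(M⁻¹)»), (2.67) p.235, (2.60) p.234] -/
theorem commZone_right (blkS : Xs → g.Site) (hρ : IsPseudoDist g.dist) {D G : Module.End ℝ (Xs → ℝ)} {χ v : Xs → ℝ}
    {ι : Type} {DE : Finset ι} {F : ι → Module.End ℝ (Xs → ℝ)} {cs ds : ι → Xs → ℝ}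
    (N : Finset g.Site) {w : g.Site → ℝ} (hw : ∀ a, 0 < w a) {κ Λ : ℝ} (hκ : 0 ≤ κ)
    (hT : ∀ a c, Real.exp (-(κ * g.dist a c)) * w c ≤ Λ * w a)
    {M s₁ s₂ C₁' B₁ δ : ℝ} (hM : 0 < M) (hs₁ : 0 ≤ s₁) (hs₂ : 0 ≤ s₂) (hC₁ : 0 ≤ C₁') (hB₁ : 0 ≤ B₁)
    (hbp : mulOp χ * D - D * mulOp χ = (∑ e ∈ DE, (F e * mulOp (cs e) + mulOp (ds e))) + mulOp v)
    (hcs : ∀ e ∈ DE, ∀ x, |cs e x| ≤ s₁ / (M * w (blkS x))) (hcsN : ∀ e ∈ DE, ∀ x, cs e x ≠ 0 → blkS x ∈ N)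
    (hds : ∀ e ∈ DE, ∀ x, |ds e x| ≤ s₂ / (M * w (blkS x) ^ 2)) (hdsN : ∀ e ∈ DE, ∀ x, ds e x ≠ 0 → blkS x ∈ N)
    (hv : ∀ x, |v x| ≤ s₂ / (M * w (blkS x) ^ 2)) (hvN : ∀ x, v x ≠ 0 → blkS x ∈ N)
    (mGF : ∀ e ∈ DE, HasMajorant blkS (G * F e) (fun a b => C₁' * w a * Real.exp (-(δ * g.dist a b))))
    (mG : HasMajorant blkS G (fun a b => B₁ * w a ^ 2 * Real.exp (-(δ * g.dist a b)))) :
    HasMajorant blkS (G * (mulOp χ * D - D * mulOp χ))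
      (fun a b => (if b ∈ N then (DE.card * (Λ * s₁ * C₁' + Λ ^ 2 * s₂ * B₁) + Λ ^ 2 * s₂ * B₁) / M else 0) *
        Real.exp (-((δ - 2 * κ) * g.dist a b))) := by
  classical
  -- (0) the transfer (2.60) in the direction `w(y) ≤ Λe^{κd}w(y′)`, and its square
  have hd0 : ∀ a b, 0 ≤ g.dist a b := fun a b => hρ.nonneg a b
  have hΛ1 : ∀ a b, w a ≤ Λ * Real.exp (κ * g.dist a b) * w b := by
    intro a b
    have h := hT b a
    rw [hρ.symm b a] at h
    have e : w a = Real.exp (κ * g.dist a b) * (Real.exp (-(κ * g.dist a b)) * w a) := by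
      rw [← mul_assoc, ← Real.exp_add, add_neg_cancel, Real.exp_zero, one_mul]
    rw [e]
    calc Real.exp (κ * g.dist a b) * (Real.exp (-(κ * g.dist a b)) * w a) ≤ Real.exp (κ * g.dist a b) * (Λ * w b) :=
          mul_le_mul_of_nonneg_left h (Real.exp_pos _).le
      _ = Λ * Real.exp (κ * g.dist a b) * w b := by ring
  -- (1) the pieces: every summand = (landed kernel) × (column multiplier over the zone)
  have hσ1 : ∀ b, 0 ≤ s₁ / (M * w b) := fun b => by
    have := hw b
    positivity
  have hσ2 : ∀ b, 0 ≤ s₂ / (M * w b ^ 2) := fun b => by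
    have := hw b
    positivity
  have h1 : ∀ e ∈ DE, HasMajorant blkS (G * F e * mulOp (cs e))
      (fun a b => C₁' * w a * Real.exp (-(δ * g.dist a b)) * (if b ∈ N then s₁ / (M * w b) else 0)) :=
    fun e he => hasMajorant_mul_mulOp_coeff blkS (mGF e he) hσ1 (hcs e he) N (hcsN e he)
  have h2 : ∀ e ∈ DE, HasMajorant blkS (G * mulOp (ds e))
      (fun a b => B₁ * w a ^ 2 * Real.exp (-(δ * g.dist a b)) * (if b ∈ N then s₂ / (M * w b ^ 2) else 0)) :=
    fun e he => hasMajorant_mul_mulOp_coeff blkS mG hσ2 (hds e he) N (hdsN e he)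
  have h3 : HasMajorant blkS (G * mulOp v)
      (fun a b => B₁ * w a ^ 2 * Real.exp (-(δ * g.dist a b)) * (if b ∈ N then s₂ / (M * w b ^ 2) else 0)) :=
    hasMajorant_mul_mulOp_coeff blkS mG hσ2 hv N hvN
  have hsum := hasMajorant_finset_sum blkS DE (fun e he => hasMajorant_add blkS (h1 e he) (h2 e he))
  have hall := hasMajorant_add blkS hsum h3
  -- (2) the operator, distributed
  have hop : G * (mulOp χ * D - D * mulOp χ) = (∑ e ∈ DE, (G * F e * mulOp (cs e) + G * mulOp (ds e))) + G * mulOp v := by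
    rw [hbp, mul_add, Finset.mul_sum]
    simp only [mul_add, mul_assoc]
  rw [hop]
  refine hasMajorant_mono blkS hall fun a b => ?_
  -- (3) pointwise: two transfers, the rate drops by 2κ
  have hΛ0 : 0 ≤ Λ := zero_le_one.trans (B6MajorantTransferSteps.one_le_transfer hw hρ hT a)
  by_cases hb : b ∈ N
  · simp only [if_pos hb]
    have hwa := hw a
    have hwb := hw b
    set dd := g.dist a b with hdd
    have hdd0 : 0 ≤ dd := hd0 a b
    have q1 : w a / w b ≤ Λ * Real.exp (κ * dd) := by
      rw [div_le_iff₀ hwb]; exact hΛ1 a b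
    have q0 : 0 ≤ w a / w b := div_nonneg hwa.le hwb.le
    have hexpκ : Real.exp (κ * dd) ≤ Real.exp (2 * κ * dd) := Real.exp_le_exp.2 (by nlinarith)
    have eE : Real.exp (-((δ - 2 * κ) * dd)) = Real.exp (-(δ * dd)) * Real.exp (2 * κ * dd) := by
      rw [← Real.exp_add]; congr 1; ring
    have e2 : (Λ * Real.exp (κ * dd)) ^ 2 = Λ ^ 2 * Real.exp (2 * κ * dd) := by
      rw [mul_pow, sq (Real.exp _), ← Real.exp_add]; ring_nf
    have hMne : M ≠ 0 := hM.ne'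
    have t1 : C₁' * w a * Real.exp (-(δ * dd)) * (s₁ / (M * w b)) ≤ Λ * s₁ * C₁' / M * Real.exp (-((δ - 2 * κ) * dd)) := by
      have e1 : C₁' * w a * Real.exp (-(δ * dd)) * (s₁ / (M * w b)) = C₁' * s₁ / M * Real.exp (-(δ * dd)) * (w a / w b) := by
        field_simp
      rw [e1, eE]
      have hq : w a / w b ≤ Λ * Real.exp (2 * κ * dd) := q1.trans (mul_le_mul_of_nonneg_left hexpκ hΛ0)
      calc C₁' * s₁ / M * Real.exp (-(δ * dd)) * (w a / w b) ≤ C₁' * s₁ / M * Real.exp (-(δ * dd)) * (Λ * Real.exp (2 * κ * dd)) :=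
            mul_le_mul_of_nonneg_left hq (by positivity)
        _ = Λ * s₁ * C₁' / M * (Real.exp (-(δ * dd)) * Real.exp (2 * κ * dd)) := by ring
    have t2 : B₁ * w a ^ 2 * Real.exp (-(δ * dd)) * (s₂ / (M * w b ^ 2)) ≤ Λ ^ 2 * s₂ * B₁ / M * Real.exp (-((δ - 2 * κ) * dd)) := by
      have e1 : B₁ * w a ^ 2 * Real.exp (-(δ * dd)) * (s₂ / (M * w b ^ 2)) = B₁ * s₂ / M * Real.exp (-(δ * dd)) * (w a / w b) ^ 2 := by
        field_simp
      rw [e1, eE]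
      have hq : (w a / w b) ^ 2 ≤ Λ ^ 2 * Real.exp (2 * κ * dd) := by
        rw [← e2]; exact pow_le_pow_left₀ q0 q1 2
      calc B₁ * s₂ / M * Real.exp (-(δ * dd)) * (w a / w b) ^ 2 ≤ B₁ * s₂ / M * Real.exp (-(δ * dd)) * (Λ ^ 2 * Real.exp (2 * κ * dd)) :=
            mul_le_mul_of_nonneg_left hq (by positivity)
        _ = Λ ^ 2 * s₂ * B₁ / M * (Real.exp (-(δ * dd)) * Real.exp (2 * κ * dd)) := by ring
    calc ∑ e ∈ DE, (C₁' * w a * Real.exp (-(δ * dd)) * (s₁ / (M * w b)) + B₁ * w a ^ 2 * Real.exp (-(δ * dd)) * (s₂ / (M * w b ^ 2))) +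
          B₁ * w a ^ 2 * Real.exp (-(δ * dd)) * (s₂ / (M * w b ^ 2))
        ≤ ∑ e ∈ DE, (Λ * s₁ * C₁' / M * Real.exp (-((δ - 2 * κ) * dd)) + Λ ^ 2 * s₂ * B₁ / M * Real.exp (-((δ - 2 * κ) * dd))) +
          Λ ^ 2 * s₂ * B₁ / M * Real.exp (-((δ - 2 * κ) * dd)) :=
          add_le_add (Finset.sum_le_sum fun e _ => add_le_add t1 t2) t2
      _ = (DE.card * (Λ * s₁ * C₁' + Λ ^ 2 * s₂ * B₁) + Λ ^ 2 * s₂ * B₁) / M * Real.exp (-((δ - 2 * κ) * dd)) := by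
          rw [Finset.sum_const, nsmul_eq_mul]
          field_simp
  · simp only [if_neg hb, mul_zero, add_zero, Finset.sum_const_zero, zero_mul, le_refl]

/-- **THE SAME WITH A BLOCK-DIAGONAL ZEROTH-ORDER PART `V`** (the block-averaging piece `[χ, Q′*aQ′]` of `[χ,Δ′]` is block-diagonal but not a multiplication
operator — p22's `s_b`-term): `hbp` ends in `+ V` with `V` of majorant `1_{y=y′}·1_N(y)·s₃/(Mw(y)²)`; the column-zone kernel gets `θ₂ = (#DE·(Λs₁C₁′ + Λ²s₂B₁) + Λ²s₃B₁)/M` (term 6 of (2.92)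
line 3 in `…B6DomainChangeP2134Sizes.line3P_hasMajorant_gk`: input `mGK`).  DISPLAYED: the by-parts decomposition
`[χ,Δ′] = Σ_{e∈DE} (F_e·c^s_e + d_e·) + v·` (`F_e` = the forward difference, `c^s_e = c_e(·−e)`, `d_e = c_e(·−e) − c_e`: the product rule
`c_e·∇_e = ∇_e·c_e(·−e) + (c_e(·−e) − c_e)·`), column bounds `|c^s_e| ≤ s₁/(Mw)`, `|d_e|, |v| ≤ s₂/(Mw²)` supported over the zone `N`, the right-difference
legs `G′F_e ~ C₁′w(y)e^{−δd}` ((2.67)₃: one COLUMN difference of `G′`), `G′ ~ B₁w²e^{−δd}` ((2.67)₁), the transfer `e^{−κd}w(y″) ≤ Λw(y)` ((2.60), `κ ≥ 0`).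
No second difference of `G′` occurs. [cite: Balaban1984PropagatorsII, (2.92) p.239 (line 3), p.238 («[χ,Δ′] gives O(M⁻¹)»), (2.67) p.235, (2.60) p.234] -/
theorem commZone_right_bd (blkS : Xs → g.Site) (hρ : IsPseudoDist g.dist) {D G : Module.End ℝ (Xs → ℝ)} {χ : Xs → ℝ}
    {ι : Type} {DE : Finset ι} {F : ι → Module.End ℝ (Xs → ℝ)} {cs ds : ι → Xs → ℝ}
    (N : Finset g.Site) {w : g.Site → ℝ} (hw : ∀ a, 0 < w a) {κ Λ : ℝ} (hκ : 0 ≤ κ)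
    (hT : ∀ a c, Real.exp (-(κ * g.dist a c)) * w c ≤ Λ * w a)
    {M s₁ s₂ C₁' B₁ δ : ℝ} (hM : 0 < M) (hs₁ : 0 ≤ s₁) (hs₂ : 0 ≤ s₂) (hC₁ : 0 ≤ C₁') (hB₁ : 0 ≤ B₁)
    {V : Module.End ℝ (Xs → ℝ)} {s₃ : ℝ} (hs₃ : 0 ≤ s₃) (hbp : mulOp χ * D - D * mulOp χ = (∑ e ∈ DE, (F e * mulOp (cs e) + mulOp (ds e))) + V)
    (hcs : ∀ e ∈ DE, ∀ x, |cs e x| ≤ s₁ / (M * w (blkS x))) (hcsN : ∀ e ∈ DE, ∀ x, cs e x ≠ 0 → blkS x ∈ N)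
    (hds : ∀ e ∈ DE, ∀ x, |ds e x| ≤ s₂ / (M * w (blkS x) ^ 2)) (hdsN : ∀ e ∈ DE, ∀ x, ds e x ≠ 0 → blkS x ∈ N)
    (hV : HasMajorant blkS V (fun a b => if a = b then (if a ∈ N then s₃ / (M * w a ^ 2) else 0) else 0))
    (mGF : ∀ e ∈ DE, HasMajorant blkS (G * F e) (fun a b => C₁' * w a * Real.exp (-(δ * g.dist a b))))
    (mG : HasMajorant blkS G (fun a b => B₁ * w a ^ 2 * Real.exp (-(δ * g.dist a b)))) :
    HasMajorant blkS (G * (mulOp χ * D - D * mulOp χ))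
      (fun a b => (if b ∈ N then (DE.card * (Λ * s₁ * C₁' + Λ ^ 2 * s₂ * B₁) + Λ ^ 2 * s₃ * B₁) / M else 0) *
        Real.exp (-((δ - 2 * κ) * g.dist a b))) := by
  classical
  -- (0) the transfer (2.60) in the direction `w(y) ≤ Λe^{κd}w(y′)`, and its square
  have hd0 : ∀ a b, 0 ≤ g.dist a b := fun a b => hρ.nonneg a b
  have hΛ1 : ∀ a b, w a ≤ Λ * Real.exp (κ * g.dist a b) * w b := by
    intro a b
    have h := hT b a
    rw [hρ.symm b a] at h
    have e : w a = Real.exp (κ * g.dist a b) * (Real.exp (-(κ * g.dist a b)) * w a) := by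
      rw [← mul_assoc, ← Real.exp_add, add_neg_cancel, Real.exp_zero, one_mul]
    rw [e]
    calc Real.exp (κ * g.dist a b) * (Real.exp (-(κ * g.dist a b)) * w a) ≤ Real.exp (κ * g.dist a b) * (Λ * w b) :=
          mul_le_mul_of_nonneg_left h (Real.exp_pos _).le
      _ = Λ * Real.exp (κ * g.dist a b) * w b := by ring
  -- (1) the pieces: every summand = (landed kernel) × (column multiplier over the zone)
  have hσ1 : ∀ b, 0 ≤ s₁ / (M * w b) := fun b => by
    have := hw b
    positivity
  have hσ2 : ∀ b, 0 ≤ s₂ / (M * w b ^ 2) := fun b => by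
    have := hw b
    positivity
  have h1 : ∀ e ∈ DE, HasMajorant blkS (G * F e * mulOp (cs e))
      (fun a b => C₁' * w a * Real.exp (-(δ * g.dist a b)) * (if b ∈ N then s₁ / (M * w b) else 0)) :=
    fun e he => hasMajorant_mul_mulOp_coeff blkS (mGF e he) hσ1 (hcs e he) N (hcsN e he)
  have h2 : ∀ e ∈ DE, HasMajorant blkS (G * mulOp (ds e))
      (fun a b => B₁ * w a ^ 2 * Real.exp (-(δ * g.dist a b)) * (if b ∈ N then s₂ / (M * w b ^ 2) else 0)) :=
    fun e he => hasMajorant_mul_mulOp_coeff blkS mG hσ2 (hds e he) N (hdsN e he)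
  have hσ3 : ∀ b, 0 ≤ s₃ / (M * w b ^ 2) := fun b => by
    have := hw b
    positivity
  have hKV : ∀ a b : g.Site, 0 ≤ (if a = b then (if a ∈ N then s₃ / (M * w a ^ 2) else 0) else 0) := fun a b => by
    split_ifs
    · exact hσ3 a
    · exact le_rfl
    · exact le_rfl
  have h3' := hasMajorant_mul blkS mG hV hKV
  have h3 : HasMajorant blkS (G * V)
      (fun a b => B₁ * w a ^ 2 * Real.exp (-(δ * g.dist a b)) * (if b ∈ N then s₃ / (M * w b ^ 2) else 0)) := by
    refine hasMajorant_mono blkS h3' fun a b => le_of_eq ?_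
    rw [Finset.sum_eq_single b (fun c _ hcb => by rw [if_neg hcb, mul_zero]) (fun hb => absurd (Finset.mem_univ b) hb), if_pos rfl]
  have hsum := hasMajorant_finset_sum blkS DE (fun e he => hasMajorant_add blkS (h1 e he) (h2 e he))
  have hall := hasMajorant_add blkS hsum h3
  -- (2) the operator, distributed
  have hop : G * (mulOp χ * D - D * mulOp χ) = (∑ e ∈ DE, (G * F e * mulOp (cs e) + G * mulOp (ds e))) + G * V := by
    rw [hbp, mul_add, Finset.mul_sum]
    simp only [mul_add, mul_assoc]
  rw [hop]
  refine hasMajorant_mono blkS hall fun a b => ?_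
  -- (3) pointwise: two transfers, the rate drops by 2κ
  have hΛ0 : 0 ≤ Λ := zero_le_one.trans (B6MajorantTransferSteps.one_le_transfer hw hρ hT a)
  by_cases hb : b ∈ N
  · simp only [if_pos hb]
    have hwa := hw a
    have hwb := hw b
    set dd := g.dist a b with hdd
    have hdd0 : 0 ≤ dd := hd0 a b
    have q1 : w a / w b ≤ Λ * Real.exp (κ * dd) := by
      rw [div_le_iff₀ hwb]; exact hΛ1 a b
    have q0 : 0 ≤ w a / w b := div_nonneg hwa.le hwb.le
    have hexpκ : Real.exp (κ * dd) ≤ Real.exp (2 * κ * dd) := Real.exp_le_exp.2 (by nlinarith)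
    have eE : Real.exp (-((δ - 2 * κ) * dd)) = Real.exp (-(δ * dd)) * Real.exp (2 * κ * dd) := by
      rw [← Real.exp_add]; congr 1; ring
    have e2 : (Λ * Real.exp (κ * dd)) ^ 2 = Λ ^ 2 * Real.exp (2 * κ * dd) := by
      rw [mul_pow, sq (Real.exp _), ← Real.exp_add]; ring_nf
    have hMne : M ≠ 0 := hM.ne'
    have t1 : C₁' * w a * Real.exp (-(δ * dd)) * (s₁ / (M * w b)) ≤ Λ * s₁ * C₁' / M * Real.exp (-((δ - 2 * κ) * dd)) := by
      have e1 : C₁' * w a * Real.exp (-(δ * dd)) * (s₁ / (M * w b)) = C₁' * s₁ / M * Real.exp (-(δ * dd)) * (w a / w b) := by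
        field_simp
      rw [e1, eE]
      have hq : w a / w b ≤ Λ * Real.exp (2 * κ * dd) := q1.trans (mul_le_mul_of_nonneg_left hexpκ hΛ0)
      calc C₁' * s₁ / M * Real.exp (-(δ * dd)) * (w a / w b) ≤ C₁' * s₁ / M * Real.exp (-(δ * dd)) * (Λ * Real.exp (2 * κ * dd)) :=
            mul_le_mul_of_nonneg_left hq (by positivity)
        _ = Λ * s₁ * C₁' / M * (Real.exp (-(δ * dd)) * Real.exp (2 * κ * dd)) := by ring
    have t2 : B₁ * w a ^ 2 * Real.exp (-(δ * dd)) * (s₂ / (M * w b ^ 2)) ≤ Λ ^ 2 * s₂ * B₁ / M * Real.exp (-((δ - 2 * κ) * dd)) := by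
      have e1 : B₁ * w a ^ 2 * Real.exp (-(δ * dd)) * (s₂ / (M * w b ^ 2)) = B₁ * s₂ / M * Real.exp (-(δ * dd)) * (w a / w b) ^ 2 := by
        field_simp
      rw [e1, eE]
      have hq : (w a / w b) ^ 2 ≤ Λ ^ 2 * Real.exp (2 * κ * dd) := by
        rw [← e2]; exact pow_le_pow_left₀ q0 q1 2
      calc B₁ * s₂ / M * Real.exp (-(δ * dd)) * (w a / w b) ^ 2 ≤ B₁ * s₂ / M * Real.exp (-(δ * dd)) * (Λ ^ 2 * Real.exp (2 * κ * dd)) :=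
            mul_le_mul_of_nonneg_left hq (by positivity)
        _ = Λ ^ 2 * s₂ * B₁ / M * (Real.exp (-(δ * dd)) * Real.exp (2 * κ * dd)) := by ring
    have t3 : B₁ * w a ^ 2 * Real.exp (-(δ * dd)) * (s₃ / (M * w b ^ 2)) ≤ Λ ^ 2 * s₃ * B₁ / M * Real.exp (-((δ - 2 * κ) * dd)) := by
      have e1 : B₁ * w a ^ 2 * Real.exp (-(δ * dd)) * (s₃ / (M * w b ^ 2)) = B₁ * s₃ / M * Real.exp (-(δ * dd)) * (w a / w b) ^ 2 := by
        field_simp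
      rw [e1, eE]
      have hq : (w a / w b) ^ 2 ≤ Λ ^ 2 * Real.exp (2 * κ * dd) := by
        rw [← e2]; exact pow_le_pow_left₀ q0 q1 2
      calc B₁ * s₃ / M * Real.exp (-(δ * dd)) * (w a / w b) ^ 2 ≤ B₁ * s₃ / M * Real.exp (-(δ * dd)) * (Λ ^ 2 * Real.exp (2 * κ * dd)) :=
            mul_le_mul_of_nonneg_left hq (by positivity)
        _ = Λ ^ 2 * s₃ * B₁ / M * (Real.exp (-(δ * dd)) * Real.exp (2 * κ * dd)) := by ring
    calc ∑ e ∈ DE, (C₁' * w a * Real.exp (-(δ * dd)) * (s₁ / (M * w b)) + B₁ * w a ^ 2 * Real.exp (-(δ * dd)) * (s₂ / (M * w b ^ 2))) +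
          B₁ * w a ^ 2 * Real.exp (-(δ * dd)) * (s₃ / (M * w b ^ 2))
        ≤ ∑ e ∈ DE, (Λ * s₁ * C₁' / M * Real.exp (-((δ - 2 * κ) * dd)) + Λ ^ 2 * s₂ * B₁ / M * Real.exp (-((δ - 2 * κ) * dd))) +
          Λ ^ 2 * s₃ * B₁ / M * Real.exp (-((δ - 2 * κ) * dd)) :=
          add_le_add (Finset.sum_le_sum fun e _ => add_le_add t1 t2) t3
      _ = (DE.card * (Λ * s₁ * C₁' + Λ ^ 2 * s₂ * B₁) + Λ ^ 2 * s₃ * B₁) / M * Real.exp (-((δ - 2 * κ) * dd)) := by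
          rw [Finset.sum_const, nsmul_eq_mul]
          field_simp
  · simp only [if_neg hb, mul_zero, add_zero, Finset.sum_const_zero, zero_mul, le_refl]

end Right

end Literature.MathematicalPhysics.QuantumFieldTheory.Balaban1983to89.B6CommutatorZoneKernels
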